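import Summits.CriticalPhenomena.SAWScalingLimit.Theses.SAWDefectDecoherence
import Literature.Barriers.CriticalPhenomena.ParafermionicHalfCauchyRiemann
import Literature.Probability.RandomPlanarGeometry.HexParafermionProofs
import Literature.Probability.LatticeModels.TriangularLatticeProofs
import Literature.Probability.LatticeModels.TriangularLatticeReflection
import Summits.CriticalPhenomena.SAWScalingLimit.Theorems.SAWDefectDecoherenceDecoherenceSynthesis
import HarnessLib

/-!
# The vertex-star inversion: signal, vertex relation and defect determine the observable
(crux `BoundaryClosureR`, stmt-CriticalPhenomena-14004, stub `stub_localL1Bound` — diagnosis)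

At a vertex `v` of the honeycomb lattice with neighbours `w₁, w₂, w₃` the three half-edge vectors
`m_k := mid{v,w_k} - c_v` are `e^{2πik/3}`-rotates of each other of length `1/(2√3)`, so the values
`F({v,w_k})` of ANY function on mid-edges are recovered from the three "Fourier channels" of the
star — the SIGNAL `S(v) := Σ_k F({v,w_k})`, the VERTEX-RELATION channel
`U(v) := Σ_k m_k F({v,w_k})` and the DEFECT (curl) channel `T(v) := Σ_k conj(m_k) F({v,w_k})` —
by the exact inversion `F({v,w_k}) = S(v)/3 + 4 conj(m_k) U(v) + 4 m_k T(v)`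
(`star_inversion`).  For the critical observable `F = F(a, ·, x_c, 5/8)` of a simply connected
domain `Λ ∋ v` with boundary root `a`, DCS Lemma 1 (`DuminilCopinSmirnov2012_lemma1_holds`, in the
tree) is `U(v) = 0`, whence `F({v,w}) = S(v)/3 + 4 m_w T(v)` and
`‖F({v,w})‖ ≤ ‖S(v)‖/3 + 2‖T(v)‖` (`observable_eq_signal_add_defect`,
`norm_observable_le_signal_add_defect`).

Consequence for the stub's local `L¹` law `δ² Σ_K ‖F_δ‖ ≤ C ‖F_δ(b_δ)‖` (written diagnosis, not
formalised beyond the star): grouping the mid-edges over `K` by black stars,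
`δ² Σ_K ‖F‖ ≤ δ² Σ_v ‖S(v)‖ + 6 δ² Σ_v ‖T(v)‖`; the route's `DefectDecoherence`
(`‖T(v)‖ ≤ C (d/δ)^{-θ} Σ_k Z({v,w_k})`, `θ > 3/4`) and `MassRatio` (`δ² Σ Z ≤ C δ^{-3/4} Z(b_δ)`)
make the DEFECT part `O(δ^{θ-3/4}) ‖F(b_δ)‖ → 0` — it is free — while the SIGNAL part
`δ² Σ_v ‖S(v)‖ = δ² Σ_v |μ̂_v(5/8)|` is the observable itself, three mid-edges at a time, with no
cancellation offered by the vertex relation: bounding it by `C ‖F(b_δ)‖` IS the open content of the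
stub (the `δ^{25/48}` decoherence of the lifted final-direction law at the signal frequency `5/8`
against the `δ^{-25/48}` excess of bulk over boundary mass), an exponent-sharp statement about
critical SAW that neither exponent crux of the route supplies.
-/

noncomputable section

open scoped BigOperators ComplexConjugate
open Literature.Probability.LatticeModels Literature.Probability.RandomPlanarGeometry
open Literature.Probability.RandomPlanarGeometry.SAW
open Literature.Barriers.CriticalPhenomena Literature.Barriers.CriticalPhenomena.HexGreen
open Literature.Barriers.CriticalPhenomena.HexKernel (vecA vecB vecC unitE0 unitE1 term hexCenter_mk
  triEmbed_unitE0 triEmbed_unitE1)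

namespace Summit.CriticalPhenomena.SAWScalingLimit.Theorems.PickHalfPlane.LocalL1

/-! ### Three-point inversion (abstract) -/

/-- **Abstract three-point inversion.** If `conj e₁ · e₁ = 1/3` and
`conj e₁ · e_k + e₁ · conj e_k = -1/3` for `k = 2, 3` (the Gram relations of three vectors of
length `1/√3` at mutual angles `2π/3`), then
`F₁ = (F₁+F₂+F₃)/3 + conj e₁ · (Σ e_k F_k) + e₁ · (Σ conj e_k F_k)` for all `F₁, F₂, F₃`. -/
theorem dft3_inversion {e₁ e₂ e₃ : ℂ} (h11 : conj e₁ * e₁ = 1 / 3)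
    (h12 : conj e₁ * e₂ + e₁ * conj e₂ = -1 / 3) (h13 : conj e₁ * e₃ + e₁ * conj e₃ = -1 / 3)
    (F₁ F₂ F₃ : ℂ) :
    F₁ = (F₁ + F₂ + F₃) / 3 + conj e₁ * (e₁ * F₁ + e₂ * F₂ + e₃ * F₃) +
      e₁ * (conj e₁ * F₁ + conj e₂ * F₂ + conj e₃ * F₃) := by
  linear_combination (-2 * F₁) * h11 - F₂ * h12 - F₃ * h13

/-! ### The Gram relations of the three centre-to-centre vectors `a, b, c` of the honeycomb -/

/-- `ζ² - ζ + 1 = 0`. -/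
theorem triZeta_rel : triZeta ^ 2 - triZeta + 1 = 0 := by
  rw [triZeta_sq]; ring

/-- `|a|² = 1/3` for `a = (1+ζ)/3`. -/
theorem conj_vecA_mul_vecA : conj vecA * vecA = 1 / 3 := by
  simp only [vecA, map_add, map_div₀, map_one, map_ofNat, conj_triZeta]
  linear_combination (-1 / 9 : ℂ) * triZeta_rel

/-- `|b|² = 1/3` for `b = a - 1`. -/
theorem conj_vecB_mul_vecB : conj vecB * vecB = 1 / 3 := by
  simp only [vecB, vecA, map_add, map_sub, map_div₀, map_one, map_ofNat, conj_triZeta]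
  linear_combination (-1 / 9 : ℂ) * triZeta_rel

/-- `|c|² = 1/3` for `c = a - ζ`. -/
theorem conj_vecC_mul_vecC : conj vecC * vecC = 1 / 3 := by
  simp only [vecC, vecA, map_add, map_sub, map_div₀, map_one, map_ofNat, conj_triZeta]
  linear_combination (-4 / 9 : ℂ) * triZeta_rel

/-- `2 Re(conj a · b) = -1/3`. -/
theorem gram_vecA_vecB : conj vecA * vecB + vecA * conj vecB = -1 / 3 := by
  simp only [vecB, vecA, map_add, map_sub, map_div₀, map_one, map_ofNat, conj_triZeta]
  linear_combination (-2 / 9 : ℂ) * triZeta_rel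

/-- `2 Re(conj a · c) = -1/3`. -/
theorem gram_vecA_vecC : conj vecA * vecC + vecA * conj vecC = -1 / 3 := by
  simp only [vecC, vecA, map_add, map_sub, map_div₀, map_one, map_ofNat, conj_triZeta]
  linear_combination (4 / 9 : ℂ) * triZeta_rel

/-- `2 Re(conj b · c) = -1/3`. -/
theorem gram_vecB_vecC : conj vecB * vecC + vecB * conj vecC = -1 / 3 := by
  simp only [vecB, vecC, vecA, map_add, map_sub, map_div₀, map_one, map_ofNat, conj_triZeta]
  linear_combination (4 / 9 : ℂ) * triZeta_rel

/-! ### The star of a vertex: explicit neighbours and half-edge vectors -/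

/-- A sum over the neighbour finset of an up face, expanded. -/
theorem sum_nbrs_up (g : HexVertex → ℂ) (y : Site 2) :
    ∑ w ∈ nbrs (y, 0), g w = g (y, 1) + g (y - unitE0, 1) + g (y - unitE1, 1) := by
  obtain ⟨h1, h2, h3⟩ := up_nbrs_ne y
  rw [nbrs_up, Finset.sum_insert (by simp [h1, h2]), Finset.sum_insert (by simp [h3]),
    Finset.sum_singleton, add_assoc]

/-- A sum over the neighbour finset of a down face, expanded. -/
theorem sum_nbrs_down (g : HexVertex → ℂ) (y : Site 2) :
    ∑ w ∈ nbrs (y, 1), g w = g (y, 0) + g (y + unitE0, 0) + g (y + unitE1, 0) := by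
  obtain ⟨h1, h2, h3⟩ := down_nbrs_ne y
  rw [nbrs_down, Finset.sum_insert (by simp [h1, h2]), Finset.sum_insert (by simp [h3]),
    Finset.sum_singleton, add_assoc]

/-- Centre-to-centre vectors at an up face: `a, b, c`. -/
theorem hexCenter_sub_up (y : Site 2) :
    hexCenter (y, 1) - hexCenter (y, 0) = vecA ∧
      hexCenter (y - unitE0, 1) - hexCenter (y, 0) = vecB ∧
        hexCenter (y - unitE1, 1) - hexCenter (y, 0) = vecC := by
  refine ⟨?_, ?_, ?_⟩ <;>
    simp [hexCenter_mk, HexKernel.triEmbed_sub, vecA, vecB, vecC] <;> ring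

/-- Centre-to-centre vectors at a down face: `-a, -b, -c`. -/
theorem hexCenter_sub_down (y : Site 2) :
    hexCenter (y, 0) - hexCenter (y, 1) = -vecA ∧
      hexCenter (y + unitE0, 0) - hexCenter (y, 1) = -vecB ∧
        hexCenter (y + unitE1, 0) - hexCenter (y, 1) = -vecC := by
  refine ⟨?_, ?_, ?_⟩ <;>
    simp [hexCenter_mk, triEmbed_add, vecA, vecB, vecC] <;> ring

/-! ### The star inversion -/

/-- The three channels of a function `F` on mid-edges at the star of `v`:
signal `S = Σ F`, vertex-relation channel `U = Σ (mid - c_v) F`, defect `T = Σ conj(mid - c_v) F`.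
(Local notation only; the statements below are written out.) -/
theorem star_inversion_of_gram {v w₁ w₂ w₃ : HexVertex} {e₁ e₂ e₃ : ℂ}
    (hc₁ : hexCenter w₁ - hexCenter v = e₁) (hc₂ : hexCenter w₂ - hexCenter v = e₂)
    (hc₃ : hexCenter w₃ - hexCenter v = e₃) (h11 : conj e₁ * e₁ = 1 / 3)
    (h12 : conj e₁ * e₂ + e₁ * conj e₂ = -1 / 3) (h13 : conj e₁ * e₃ + e₁ * conj e₃ = -1 / 3)
    (F : Sym2 HexVertex → ℂ) :
    F s(v, w₁) = (F s(v, w₁) + F s(v, w₂) + F s(v, w₃)) / 3 +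
      4 * conj (hexMidpoint s(v, w₁) - hexCenter v) *
        (term F v w₁ + term F v w₂ + term F v w₃) +
      4 * (hexMidpoint s(v, w₁) - hexCenter v) *
        (conj (hexMidpoint s(v, w₁) - hexCenter v) * F s(v, w₁) +
          conj (hexMidpoint s(v, w₂) - hexCenter v) * F s(v, w₂) +
          conj (hexMidpoint s(v, w₃) - hexCenter v) * F s(v, w₃)) := by
  simp only [term, DecoherenceSynthesis.hexMidpoint_sub_hexCenter, hc₁, hc₂, hc₃, map_div₀, map_ofNat]
  linear_combination dft3_inversion h11 h12 h13 (F s(v, w₁)) (F s(v, w₂)) (F s(v, w₃))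

/-- **Star inversion** (any function on mid-edges, any vertex `v`, any neighbour `w`):
`F({v,w}) = S(v)/3 + 4 conj(mid{v,w} - c_v) · U(v) + 4 (mid{v,w} - c_v) · T(v)` with
`S(v) = Σ_{w' ∼ v} F({v,w'})`, `U(v) = Σ_{w' ∼ v} (mid{v,w'} - c_v) F({v,w'})` (the vertex-relation
combination of DCS Lemma 1) and `T(v) = Σ_{w' ∼ v} conj(mid{v,w'} - c_v) F({v,w'})` (the defect of
the route's `DefectDecoherence`). -/
theorem star_inversion (F : Sym2 HexVertex → ℂ) (v w : HexVertex) (hw : hexGraph.Adj v w) :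
    F s(v, w) = (∑ w' ∈ nbrs v, F s(v, w')) / 3 +
      4 * conj (hexMidpoint s(v, w) - hexCenter v) * ∑ w' ∈ nbrs v, term F v w' +
      4 * (hexMidpoint s(v, w) - hexCenter v) *
        ∑ w' ∈ nbrs v, conj (hexMidpoint s(v, w') - hexCenter v) * F s(v, w') := by
  have hw' : w ∈ nbrs v := (mem_nbrs_iff v w).2 hw
  obtain ⟨y, i⟩ := v
  fin_cases i
  · obtain ⟨hA, hB, hC⟩ := hexCenter_sub_up y
    simp only [Fin.zero_eta, Fin.isValue, sum_nbrs_up]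
    simp only [Fin.zero_eta, Fin.isValue, nbrs_up, Finset.mem_insert, Finset.mem_singleton] at hw'
    rcases hw' with rfl | rfl | rfl
    · exact star_inversion_of_gram hA hB hC conj_vecA_mul_vecA gram_vecA_vecB gram_vecA_vecC F
    · have key := star_inversion_of_gram hB hA hC conj_vecB_mul_vecB
        (by linear_combination gram_vecA_vecB) gram_vecB_vecC F
      linear_combination key
    · have key := star_inversion_of_gram hC hA hB conj_vecC_mul_vecC
        (by linear_combination gram_vecA_vecC) (by linear_combination gram_vecB_vecC) F
      linear_combination key
  · obtain ⟨hA, hB, hC⟩ := hexCenter_sub_down y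
    have nA : conj (-vecA) * -vecA = 1 / 3 := by rw [map_neg, neg_mul_neg]; exact conj_vecA_mul_vecA
    have nB : conj (-vecB) * -vecB = 1 / 3 := by rw [map_neg, neg_mul_neg]; exact conj_vecB_mul_vecB
    have nC : conj (-vecC) * -vecC = 1 / 3 := by rw [map_neg, neg_mul_neg]; exact conj_vecC_mul_vecC
    have nAB : conj (-vecA) * -vecB + -vecA * conj (-vecB) = -1 / 3 := by
      simp only [map_neg, neg_mul_neg]; exact gram_vecA_vecB
    have nAC : conj (-vecA) * -vecC + -vecA * conj (-vecC) = -1 / 3 := by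
      simp only [map_neg, neg_mul_neg]; exact gram_vecA_vecC
    have nBC : conj (-vecB) * -vecC + -vecB * conj (-vecC) = -1 / 3 := by
      simp only [map_neg, neg_mul_neg]; exact gram_vecB_vecC
    simp only [Fin.mk_one, Fin.isValue, sum_nbrs_down]
    simp only [Fin.mk_one, Fin.isValue, nbrs_down, Finset.mem_insert, Finset.mem_singleton] at hw'
    rcases hw' with rfl | rfl | rfl
    · exact star_inversion_of_gram hA hB hC nA nAB nAC F
    · have key := star_inversion_of_gram hB hA hC nB (by linear_combination nAB) nBC F
      linear_combination key
    · have key := star_inversion_of_gram hC hA hB nC (by linear_combination nAC)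
        (by linear_combination nBC) F
      linear_combination key

/-! ### With the vertex relation: the observable is signal plus defect -/

/-- **DCS Lemma 1 in channel form**: for a simply connected domain `Λ`, a boundary root `a` and
`v ∈ Λ`, the vertex-relation channel of the critical observable vanishes,
`Σ_{w ∼ v} (mid{v,w} - c_v) F_{x_c,5/8}({v,w}) = 0`. -/
theorem vertexChannel_eq_zero {Λ : Finset HexVertex} (hΛ : hexDomainSimplyConnected Λ)
    {a : Sym2 HexVertex} (ha : a ∈ hexDomainBoundary Λ) {v : HexVertex} (hv : v ∈ Λ) :
    ∑ w ∈ nbrs v, term (hexParafermionicObservable Λ a hexCriticalFugacity (5 / 8)) v w = 0 :=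
  (satisfiesVertexRelations_iff_sum Λ _).1
    (lemma1_iff.1 DuminilCopinSmirnov2012_lemma1_holds Λ hΛ a ha) v hv

/-- **The critical observable is signal plus defect at every star**: for `Λ` simply connected,
`a ∈ ∂Ω`, `v ∈ Λ` and `w ∼ v`,
`F({v,w}) = (Σ_{w'∼v} F({v,w'}))/3 + 4 (mid{v,w} - c_v) · Σ_{w'∼v} conj(mid{v,w'} - c_v) F({v,w'})`. -/
theorem observable_eq_signal_add_defect {Λ : Finset HexVertex} (hΛ : hexDomainSimplyConnected Λ)
    {a : Sym2 HexVertex} (ha : a ∈ hexDomainBoundary Λ) {v w : HexVertex} (hv : v ∈ Λ)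
    (hw : hexGraph.Adj v w) :
    hexParafermionicObservable Λ a hexCriticalFugacity (5 / 8) s(v, w) =
      (∑ w' ∈ nbrs v, hexParafermionicObservable Λ a hexCriticalFugacity (5 / 8) s(v, w')) / 3 +
      4 * (hexMidpoint s(v, w) - hexCenter v) *
        ∑ w' ∈ nbrs v, conj (hexMidpoint s(v, w') - hexCenter v) *
          hexParafermionicObservable Λ a hexCriticalFugacity (5 / 8) s(v, w') := by
  have key := star_inversion (hexParafermionicObservable Λ a hexCriticalFugacity (5 / 8)) v w hw
  rw [vertexChannel_eq_zero hΛ ha hv, mul_zero, add_zero] at key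
  exact key

/-- **Norm form**: `‖F({v,w})‖ ≤ ‖S(v)‖/3 + 2‖T(v)‖` (`‖mid{v,w} - c_v‖ ≤ 1/2`), `S` the star
signal and `T` the star defect of the critical observable, at every vertex of a simply connected
domain with boundary root. The defect part is what `DefectDecoherence` + `MassRatio` control on
compacts (with room `δ^{θ-3/4} → 0`); the signal part carries the whole open content of the local
`L¹` law. -/
theorem norm_observable_le_signal_add_defect {Λ : Finset HexVertex}
    (hΛ : hexDomainSimplyConnected Λ) {a : Sym2 HexVertex} (ha : a ∈ hexDomainBoundary Λ)
    {v w : HexVertex} (hv : v ∈ Λ) (hw : hexGraph.Adj v w) :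
    ‖hexParafermionicObservable Λ a hexCriticalFugacity (5 / 8) s(v, w)‖ ≤
      ‖∑ w' ∈ nbrs v, hexParafermionicObservable Λ a hexCriticalFugacity (5 / 8) s(v, w')‖ / 3 +
      2 * ‖∑ w' ∈ nbrs v, conj (hexMidpoint s(v, w') - hexCenter v) *
          hexParafermionicObservable Λ a hexCriticalFugacity (5 / 8) s(v, w')‖ := by
  rw [observable_eq_signal_add_defect hΛ ha hv hw]
  refine (norm_add_le _ _).trans (add_le_add ?_ ?_)
  · rw [norm_div, Complex.norm_ofNat]
  · rw [norm_mul, norm_mul, Complex.norm_ofNat]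
    have h := DecoherenceSynthesis.norm_hexMidpoint_sub_hexCenter_le hw
    have hT := norm_nonneg (∑ w' ∈ nbrs v, conj (hexMidpoint s(v, w') - hexCenter v) *
          hexParafermionicObservable Λ a hexCriticalFugacity (5 / 8) s(v, w'))
    nlinarith

/-- **Per-star bound under a defect estimate.** If at the star of `v ∈ Λ` (simply connected, boundary
root `a`) the defect is bounded by `Dv` times the star mass `Σ_{w'∼v} Z({v,w'})`
(`Z = ‖F_{x_c,0}‖`; this is the shape of `DefectDecoherence` at an `R`-deep vertex, `Dv = C R^{-θ}`,
where `Λ.filter (adjacent to v) = nbrs v`), then the `L¹` mass of the observable over the star is at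
most the star signal plus `6 Dv` star masses:
`Σ_{w∼v} ‖F({v,w})‖ ≤ ‖S(v)‖ + 6 Dv Σ_{w∼v} Z({v,w})`. -/
theorem star_l1_le_signal_add_defect {Λ : Finset HexVertex} (hΛ : hexDomainSimplyConnected Λ)
    {a : Sym2 HexVertex} (ha : a ∈ hexDomainBoundary Λ) {v : HexVertex} (hv : v ∈ Λ) {Dv : ℝ}
    (hdef : ‖∑ w' ∈ nbrs v, conj (hexMidpoint s(v, w') - hexCenter v) *
        hexParafermionicObservable Λ a hexCriticalFugacity (5 / 8) s(v, w')‖ ≤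
      Dv * ∑ w' ∈ nbrs v, ‖hexParafermionicObservable Λ a hexCriticalFugacity 0 s(v, w')‖) :
    ∑ w ∈ nbrs v, ‖hexParafermionicObservable Λ a hexCriticalFugacity (5 / 8) s(v, w)‖ ≤
      ‖∑ w' ∈ nbrs v, hexParafermionicObservable Λ a hexCriticalFugacity (5 / 8) s(v, w')‖ +
      6 * Dv * ∑ w' ∈ nbrs v, ‖hexParafermionicObservable Λ a hexCriticalFugacity 0 s(v, w')‖ := by
  set S := ‖∑ w' ∈ nbrs v, hexParafermionicObservable Λ a hexCriticalFugacity (5 / 8) s(v, w')‖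
  set T := ‖∑ w' ∈ nbrs v, conj (hexMidpoint s(v, w') - hexCenter v) *
        hexParafermionicObservable Λ a hexCriticalFugacity (5 / 8) s(v, w')‖
  have hcard : (nbrs v).card = 3 := by
    obtain ⟨y, i⟩ := v
    fin_cases i
    · obtain ⟨h1, h2, h3⟩ := up_nbrs_ne y
      simp only [Fin.zero_eta, Fin.isValue, nbrs_up]
      rw [Finset.card_insert_of_notMem (by simp [h1, h2]), Finset.card_insert_of_notMem (by simp [h3]),
        Finset.card_singleton]
    · obtain ⟨h1, h2, h3⟩ := down_nbrs_ne y
      simp only [Fin.mk_one, Fin.isValue, nbrs_down]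
      rw [Finset.card_insert_of_notMem (by simp [h1, h2]), Finset.card_insert_of_notMem (by simp [h3]),
        Finset.card_singleton]
  calc ∑ w ∈ nbrs v, ‖hexParafermionicObservable Λ a hexCriticalFugacity (5 / 8) s(v, w)‖
      ≤ ∑ _w ∈ nbrs v, (S / 3 + 2 * T) := Finset.sum_le_sum fun w hw =>
          norm_observable_le_signal_add_defect hΛ ha hv ((mem_nbrs_iff v w).1 hw)
    _ = S + 6 * T := by rw [Finset.sum_const, hcard, nsmul_eq_mul]; push_cast; ring
    _ ≤ S + 6 * (Dv * ∑ w' ∈ nbrs v,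
          ‖hexParafermionicObservable Λ a hexCriticalFugacity 0 s(v, w')‖) := by nlinarith
    _ = _ := by ring

/-- **Registered sub-goal `stub_localL1Bound_starInversion`** (crux item stmt-CriticalPhenomena-14004,
stub `stub_localL1Bound`): at every vertex `v` of a simply connected domain with boundary root `a`
and every neighbour `w`, the critical observable is SIGNAL plus DEFECT,
`F({v,w}) = (Σ_{w'∼v} F({v,w'}))/3 + 4 (mid{v,w} - c_v) Σ_{w'∼v} conj(mid{v,w'} - c_v) F({v,w'})`
(star inversion + DCS Lemma 1). -/
theorem stub_localL1Bound_starInversion : ∀ (Λ : Finset HexVertex), hexDomainSimplyConnected Λ → ∀ (a : Sym2 HexVertex), a ∈ hexDomainBoundary Λ → ∀ (v w : HexVertex), v ∈ Λ → hexGraph.Adj v w → hexParafermionicObservable Λ a hexCriticalFugacity (5 / 8) s(v, w) = (∑ w' ∈ Literature.Barriers.CriticalPhenomena.HexGreen.nbrs v, hexParafermionicObservable Λ a hexCriticalFugacity (5 / 8) s(v, w')) / 3 + 4 * (hexMidpoint s(v, w) - hexCenter v) * ∑ w' ∈ Literature.Barriers.CriticalPhenomena.HexGreen.nbrs v, (starRingEnd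 ℂ) (hexMidpoint s(v, w') - hexCenter v) * hexParafermionicObservable Λ a hexCriticalFugacity (5 / 8) s(v, w') :=
  fun _ hΛ _ ha _ _ hv hw => observable_eq_signal_add_defect hΛ ha hv hw

end Summit.CriticalPhenomena.SAWScalingLimit.Theorems.PickHalfPlane.LocalL1

end
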